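import Literature.AnabelianGeometry.EtaleTheta.Discharge.Sec2ReductionProofs
import Literature.AnabelianGeometry.EtaleTheta.ThetaRigidityLevels

/-!
# [EtTh] §2 discharge: Corollary 2.19 (ii) (discrete rigidity), STRONG form — any projective system of
# mono-theta environments is isomorphic to the natural system of ANY fixed compatible family `η₀`

Mochizuki, *The Étale Theta Function and its Frobenioid-theoretic Manifestations* [EtTh],
Publ. RIMS 45 (2009), §2, Cor 2.19 (ii) pp.64–65 ("there exists a collection of isomorphisms
`α_M : M_M ⥲ M•_M` such that `γ*_{M',M} ∘ α_{M'} = α_M ∘ β*_{M',M}`", with `β*` the natural system of a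
FIXED `η̈^Θ`, Cor 2.16 p.54), proof p.66 (vanishing of `R¹lim {Hom(ℤ/2,ℤ/N)}` and `R¹lim {μ_N}`)
(locators `p.N` = PDF pages of the PRIMS text; bib key `MochizukiEtTh2009`). PROOF-ONLY companion
(no `def`, no new named fact; seat abc-iut-L2-d1, DAG node `EtTh:Cor2.19(ii)`) of `ThetaSystems.lean`
(seat abc-iut-L2-t2), answering the p406836 review (point 2: the typed `Cor219_ii` only compared a system
with the natural system of ITS OWN cocycles).

`ThetaEnvTower.exists_iso_of_systems` — for a projective system `S` (cocycles `η_M`, transition twists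
`a_{M',M}`) and ANY compatible family `η₀` in the collections, there are isomorphisms
`α_M : M_M(η₀_M) ≅ M_M(η_M)` with `a_{M',M} ∘ red ∘ α_{M'} = α_M ∘ red`. Inputs (hypotheses): those of
`cor219_ii_of` (Cor 2.18 (iii), (iv) lifting/fibres), the two-family reduction of isomorphisms
(`exists_iso_reduces`, here a hypothesis; proved from temp-slimness + Kummer lifting in
`Discharge/Sec2ReductionProofs.lean`) and Cor 2.18 (ii) (`M(η) ≅ M(η')` at each level — the
"`R¹lim {μ_N}`" input). Route: transport `S` along level-wise isomorphisms `e_M : M(η₀_M) ≅ M(η_M)` into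
a system `S₀` on `η₀` (twists `e_M⁻¹ ∘ a_{M',M} ∘ red(e_{M'})`), apply `cor219_ii_of` to `S₀`, compose.
HONEST FRAMING: conditional discharge; no side is taken on [IUTchIII] Cor 3.12; typed ≠ discharged
elsewhere.
-/

namespace Literature.AnabelianGeometry.EtaleTheta

universe u

namespace ThetaEnvTower

variable {E : Set ℕ+} (T : ThetaEnvTower.{u} E)

/-- Model environments attached to EQUAL cocycles have the same isomorphisms (two-model form).
[cite: MochizukiEtTh2009, Def 2.13(ii) p.47] -/
theorem exists_iso_congr₂ {M : E} {ηa ηa' ηb ηb' : T.PiYdd → T.mu M} (hA : ηa = ηa') (hB : ηb = ηb')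
    (ha : ηa ∈ T.thetaCocycles M) (ha' : ηa' ∈ T.thetaCocycles M) (hb : ηb ∈ T.thetaCocycles M)
    (hb' : ηb' ∈ T.thetaCocycles M)
    (α : ((T.level M).modelMono ha).Iso ((T.level M).modelMono hb)) :
    ∃ β : ((T.level M).modelMono ha').Iso ((T.level M).modelMono hb'),
      β.e.toMulEquiv = α.e.toMulEquiv := by
  subst hA hB
  exact ⟨α, rfl⟩

/-- **Corollary 2.19 (ii) (Discrete Rigidity), strong form — DISCHARGED modulo Cor 2.18 (ii), (iii), (iv)**:
every projective system of mono-theta environments is isomorphic, compatibly with the transition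
maps, to the natural projective system of any fixed compatible family `η₀` of theta cocycles.
[cite: MochizukiEtTh2009, Cor 2.19(ii) p.64] -/
theorem exists_iso_of_systems
    (hslim : ∀ x : T.PiX, (∀ h : T.PiY, x * h * x⁻¹ = h) → x = 1)
    (hq : ∀ M : E, centralizerUnion (T.level M).env =
      (CycEnvelope.proj (T.level M).augY (T.level M).chi).ker)
    (hlift : ∀ (M : E) (η : T.PiYdd → T.mu M) (hη : η ∈ T.thetaCocycles M) (γ : T.PiX ≃ₜ* T.PiX),
      T.PiY.map γ.toMulEquiv.toMonoidHom = T.PiY →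
      ∃ α : ((T.level M).modelMono hη).Iso ((T.level M).modelMono hη),
        ∀ x, ((CycEnvelope.proj (T.level M).augY (T.level M).chi (α.e x) : T.PiY) : T.PiX) =
          γ (CycEnvelope.proj (T.level M).augY (T.level M).chi x : T.PiY))
    (hfib : ∀ (M : E) (η : T.PiYdd → T.mu M) (hη : η ∈ T.thetaCocycles M)
      (α : ((T.level M).modelMono hη).Iso ((T.level M).modelMono hη)),
      (∀ x, CycEnvelope.proj (T.level M).augY (T.level M).chi (α.e x) =
        CycEnvelope.proj (T.level M).augY (T.level M).chi x) →
      ∃ (φ : T.PiY →* T.mu M) (_ : ∀ g : T.PiYdd, φ ((T.level M).inclYdd g) = 1) (c : T.mu M),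
        ∀ x : (T.level M).env, α.e x =
          MulAut.conj (CycEnvelope.inMu (T.level M).augY (T.level M).chi c)
            (CycEnvelope.inMu (T.level M).augY (T.level M).chi
              (φ (CycEnvelope.proj (T.level M).augY (T.level M).chi x)) * x))
    (hred2 : ∀ (M M' : E) (h : (M : ℕ+) ∣ M') (η₀' η' : T.PiYdd → T.mu M')
      (hη₀' : η₀' ∈ T.thetaCocycles M') (hη' : η' ∈ T.thetaCocycles M')
      (α' : ((T.level M').modelMono hη₀').Iso ((T.level M').modelMono hη')),
      ∃ α : ((T.level M).modelMono (T.red_cocycle_mem M M' h η₀' hη₀')).Iso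
          ((T.level M).modelMono (T.red_cocycle_mem M M' h η' hη')),
        T.Reduces h α'.e.toMulEquiv α.e.toMulEquiv)
    (h218ii : ∀ (M : E) (η η' : T.PiYdd → T.mu M) (hη : η ∈ T.thetaCocycles M)
      (hη' : η' ∈ T.thetaCocycles M),
      Nonempty (((T.level M).modelMono hη).Iso ((T.level M).modelMono hη')))
    (S : T.MTESystem) (η₀ : ∀ M : E, T.PiYdd → T.mu M) (hη₀ : ∀ M, η₀ M ∈ T.thetaCocycles M)
    (hη₀c : ∀ (M M' : E) (h : (M : ℕ+) ∣ M'), T.red M M' h ∘ η₀ M' = η₀ M) :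
    ∃ α : ∀ M : E, ((T.level M).modelMono (hη₀ M)).Iso ((T.level M).modelMono (S.mem M)),
      ∀ (M M' : E) (h : (M : ℕ+) ∣ M') (x : (T.level M').env),
        S.a M M' h (T.redEnv M M' h ((α M').e x)) = (α M).e (T.redEnv M M' h x) := by
  -- the same-family reduction (`Cor218_iv_reduction`) is a special case of `hred2`
  have hred : T.Cor218_iv_reduction := fun M M' h η' hη' α' => hred2 M M' h η' η' hη' hη' α'
  -- level-wise isomorphisms `e_M : M(η₀_M) ≅ M(η_M)` (Cor 2.18 (ii))
  have he : ∀ M : E, ∃ e : ((T.level M).modelMono (hη₀ M)).Iso ((T.level M).modelMono (S.mem M)),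
      True := fun M => ⟨(h218ii M _ _ (hη₀ M) (S.mem M)).some, trivial⟩
  choose e _ using he
  -- their reductions `ρe M M' h : M(η₀_M) ≅ M(η_M)` along `red`
  have hρe : ∀ (M M' : E) (h : (M : ℕ+) ∣ M'),
      ∃ r : ((T.level M).modelMono (hη₀ M)).Iso ((T.level M).modelMono (S.mem M)),
        T.Reduces h (e M').e.toMulEquiv r.e.toMulEquiv := by
    intro M M' h
    obtain ⟨r₀, hr₀⟩ := hred2 M M' h _ _ (hη₀ M') (S.mem M') (e M')
    obtain ⟨r, hr⟩ := T.exists_iso_congr₂ (hη₀c M M' h) (S.compat M M' h)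
      (T.red_cocycle_mem M M' h _ (hη₀ M')) (hη₀ M) (T.red_cocycle_mem M M' h _ (S.mem M'))
      (S.mem M) r₀
    exact ⟨r, fun x => by rw [hr]; exact hr₀ x⟩
  choose ρe hρe using hρe
  -- reductions of the twists `S.a M' M'' h'` along `h : M ∣ M'`
  choose aI haI using S.isAut
  have hρa : ∀ (M M' M'' : E) (h : (M : ℕ+) ∣ M') (h' : (M' : ℕ+) ∣ M''),
      ∃ r : MulAut (T.level M).env, T.Reduces h (S.a M' M'' h') r := by
    intro M M' M'' h h'
    obtain ⟨r₀, hr₀⟩ := hred M M' h _ (S.mem M') (aI M' M'' h')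
    exact ⟨r₀.e.toMulEquiv, fun x => by rw [← haI]; exact hr₀ x⟩
  choose ρa hρa using hρa
  -- the transported twists on the `η₀`-models
  let a₀ : ∀ M M' : E, ((M : ℕ+) ∣ M') → MulAut (T.level M).env := fun M M' h =>
    (e M).e.toMulEquiv⁻¹ * S.a M M' h * (ρe M M' h).e.toMulEquiv
  have ha₀aut : ∀ (M M' : E) (h : (M : ℕ+) ∣ M'),
      ∃ β : ((T.level M).modelMono (hη₀ M)).Iso ((T.level M).modelMono (hη₀ M)),
        β.e.toMulEquiv = a₀ M M' h := by
    intro M M' h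
    obtain ⟨β₁, hβ₁⟩ := ThetaEnvData.exists_iso_trans (ρe M M' h) (aI M M' h)
    obtain ⟨β₂, hβ₂⟩ := ThetaEnvData.exists_iso_symm (e M)
    obtain ⟨β, hβ⟩ := ThetaEnvData.exists_iso_trans β₁ β₂
    refine ⟨β, MulEquiv.ext fun x => ?_⟩
    change β.e x = ((e M).e.toMulEquiv⁻¹ * S.a M M' h * (ρe M M' h).e.toMulEquiv) x
    rw [hβ, hβ₂, hβ₁, MulAut.mul_apply, MulAut.mul_apply, MulAut.inv_apply, ← haI]
    rfl
  have ha₀self : ∀ (M : E) (h : (M : ℕ+) ∣ M), a₀ M M h = 1 := by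
    intro M h
    change (e M).e.toMulEquiv⁻¹ * S.a M M h * (ρe M M h).e.toMulEquiv = 1
    rw [S.a_self, mul_one, reduces_unique (hρe M M h) (reduces_self _), inv_mul_cancel]
  -- the cocycle identity of the transported twists
  have ha₀comp : ∀ (M M' M'' : E) (h : (M : ℕ+) ∣ M') (h' : (M' : ℕ+) ∣ M''),
      a₀ M M'' (h.trans h') = a₀ M M' h * ((ρe M M' h).e.toMulEquiv⁻¹ * ρa M M' M'' h h' *
        (ρe M M'' (h.trans h')).e.toMulEquiv) := by
    intro M M' M'' h h'
    change (e M).e.toMulEquiv⁻¹ * S.a M M'' (h.trans h') * (ρe M M'' (h.trans h')).e.toMulEquiv =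
      (e M).e.toMulEquiv⁻¹ * S.a M M' h * (ρe M M' h).e.toMulEquiv *
        ((ρe M M' h).e.toMulEquiv⁻¹ * ρa M M' M'' h h' * (ρe M M'' (h.trans h')).e.toMulEquiv)
    rw [S.a_comp_eq h h' (hρa M M' M'' h h')]
    group
  have ha₀red : ∀ (M M' M'' : E) (h : (M : ℕ+) ∣ M') (h' : (M' : ℕ+) ∣ M''),
      T.Reduces h (a₀ M' M'' h') ((ρe M M' h).e.toMulEquiv⁻¹ * ρa M M' M'' h h' *
        (ρe M M'' (h.trans h')).e.toMulEquiv) := by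
    intro M M' M'' h h'
    refine reduces_mul (reduces_mul (reduces_inv (hρe M M' h)) (hρa M M' M'' h h')) ?_
    -- the reduction of `ρe M' M'' h'` along `h` is `ρe M M'' (h ⊚ h')`
    obtain ⟨r, hr⟩ := hred2 M M' h _ _ (hη₀ M') (S.mem M') (ρe M' M'' h')
    have : (ρe M M'' (h.trans h')).e.toMulEquiv = r.e.toMulEquiv :=
      reduces_unique (hρe M M'' (h.trans h')) (reduces_comp (hρe M' M'' h') hr)
    rw [this]
    exact hr
  let S₀ : T.MTESystem :=
    { η := η₀, mem := hη₀, compat := hη₀c, a := a₀, isAut := ha₀aut, a_self := ha₀self,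
      a_comp := fun M M' M'' h h' x => by
        rw [ha₀comp M M' M'' h h', MulAut.mul_apply, T.redEnv_comp M M' M'' h h',
          ha₀red M M' M'' h h'] }
  -- discrete rigidity for `S₀`
  obtain ⟨α₀, hα₀aut, hα₀⟩ := T.cor219_ii_of hslim hq hlift hfib hred S₀
  -- compose with `e_M`
  have hα : ∀ M : E, ∃ β : ((T.level M).modelMono (hη₀ M)).Iso ((T.level M).modelMono (S.mem M)),
      ∀ x, β.e x = (e M).e (α₀ M x) := by
    intro M
    obtain ⟨β₀, hβ₀⟩ := hα₀aut M
    obtain ⟨β, hβ⟩ := ThetaEnvData.exists_iso_trans β₀ (e M)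
    exact ⟨β, fun x => by rw [hβ, ← hβ₀]; rfl⟩
  choose α hα using hα
  refine ⟨α, fun M M' h x => ?_⟩
  rw [hα, hα, ← hα₀ M M' h x]
  change _ = (e M).e.toMulEquiv (((e M).e.toMulEquiv⁻¹ * S.a M M' h * (ρe M M' h).e.toMulEquiv) _)
  rw [MulAut.mul_apply, MulAut.mul_apply, MulAut.inv_apply, MulEquiv.apply_symm_apply]
  exact congrArg _ (hρe M M' h _)

/-- **Corollary 2.19 (ii), strong form — DISCHARGED modulo temp-slimness of `Π^tp_X`, Kummer lifting,
Cor 2.18 (ii) and the Cor 2.18 (iv) facts `Cor218_iv_surjective`, `Cor218_iv_fibre` (first clause).**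
[cite: MochizukiEtTh2009, Cor 2.19(ii) p.64] -/
theorem exists_iso_of_systems_tempSlim
    (hts : ∀ U : Subgroup T.PiX, IsOpen (U : Set T.PiX) →
      ∀ z : T.PiX, (∀ u ∈ U, z * u = u * z) → z = 1)
    (hKL : ∀ (M M' : E) (h : (M : ℕ+) ∣ M') (δ : T.G → T.mu M)
      (hδ : CycEnvelope.IsEnvCocycle (T.level M).augY (T.level M).chi (δ ∘ (T.level M).augY)),
      CycEnvelope.shift hδ ∈ contMulAut (T.level M).env →
      ∃ (δ' : T.G → T.mu M')
        (hδ' : CycEnvelope.IsEnvCocycle (T.level M').augY (T.level M').chi (δ' ∘ (T.level M').augY)),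
        CycEnvelope.shift hδ' ∈ contMulAut (T.level M').env ∧ ∀ g, T.red M M' h (δ' g) = δ g)
    (hlift : ∀ M : E, (T.level M).Cor218_iv_surjective)
    (hfib : ∀ M : E, (T.level M).Cor218_iv_fibre) (h218ii : ∀ M : E, (T.level M).Cor218_ii)
    (S : T.MTESystem) (η₀ : ∀ M : E, T.PiYdd → T.mu M) (hη₀ : ∀ M, η₀ M ∈ T.thetaCocycles M)
    (hη₀c : ∀ (M M' : E) (h : (M : ℕ+) ∣ M'), T.red M M' h ∘ η₀ M' = η₀ M) :
    ∃ α : ∀ M : E, ((T.level M).modelMono (hη₀ M)).Iso ((T.level M).modelMono (S.mem M)),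
      ∀ (M M' : E) (h : (M : ℕ+) ∣ M') (x : (T.level M').env),
        S.a M M' h (T.redEnv M M' h ((α M').e x)) = (α M).e (T.redEnv M M' h x) :=
  T.exists_iso_of_systems (T.cor218_iii_of_tempSlim hts).1 (T.cor218_iii_of_tempSlim hts).2
    (fun M η hη γ hγ => hlift M η hη γ hγ) (fun M η hη => (hfib M η hη).1)
    (T.exists_iso_reduces hts hKL) (fun M η η' hη hη' => ⟨(h218ii M η η' hη hη').choose⟩)
    S η₀ hη₀ hη₀c

end ThetaEnvTower

end Literature.AnabelianGeometry.EtaleTheta
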